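import Mathlib
import Literature.Computability.AlgebraicComplexity.RealTauKnownCases

/-!
# Crux `MatrixDescartes` (stmt-ValiantsHypothesis-18050), line `Lift` — registered stub `stub_vLaw_two`

The V-LAW AT `n = 2`: for real `2 × 2` matrices `J, P, Q` with `P, Q ⪰ 0` and exponents
`d₁ < e < d₂`, the determinant of the two-sided pencil `X^e • J + X^{d₁} • P + X^{d₂} • Q` has at
most `4 = 2 · 2` distinct positive zeros.

Proof.  Expanding `Matrix.det_fin_two`, the determinant is the six-term exponential sum
`det P · X^{2d₁} + c₁ X^{d₁+e} + det J · X^{2e} + c₃ X^{d₁+d₂} + c₄ X^{e+d₂} + det Q · X^{2d₂}`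
(`StubVLawTwo.det_pencil_eq`); the extreme exponents `2d₁ < … < 2d₂` are unshared and carry the
coefficients `det P ≥ 0`, `det Q ≥ 0` (`Matrix.PosSemidef.det_nonneg`).  By Mathlib's Descartes rule
(`Polynomial.roots_countP_pos_le_signVariations`) it suffices to bound the sign variations by `4`
(`StubVLawTwo.signVariations_le_four`): a nonzero polynomial has fewer sign variations than
monomials (tree lemma `Literature.Computability.AlgebraicComplexity.signVariations_lt_card_support`),
so if `det P = 0` or `det Q = 0` at most five monomials survive and there are at most `4` variations;
if both are positive the leading and trailing coefficients are positive, so the number of sign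
variations is EVEN (`StubVLawTwo.even_signVariations_iff`, the parity half of Descartes' rule, by
induction on the number of monomials via `Polynomial.signVariations_eq_eraseLead_add_ite`) and
`< 6`, hence `≤ 4`.

Elementary; Mathlib plus the tree's sparse Descartes lemma (axioms `propext`, `Classical.choice`,
`Quot.sound`).
-/

-- layout Summits/ValiantsHypothesis/ValiantsHypothesis forces the duplicated namespace component
set_option linter.dupNamespace false

namespace Summit.ValiantsHypothesis.ValiantsHypothesis.Theorems.LacunarySymmetroidMatrixDescartes

open Polynomial Finset
open Literature.Computability.AlgebraicComplexity (signVariations_lt_card_support)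

namespace StubVLawTwo

/-! ### Parity of the number of sign variations -/

/-- Sign bookkeeping for the parity induction, opposite leading signs: a finite check on `SignType`. -/
theorem sign_key_neg :
    ∀ a b c : SignType, a ≠ 0 → b ≠ 0 → c ≠ 0 → a = -b → (¬b = c ↔ a = c) := by
  intro a b c
  cases a <;> cases b <;> cases c <;> decide

/-- Sign bookkeeping for the parity induction, equal leading signs: a finite check on `SignType`. -/
theorem sign_key_pos :
    ∀ a b c : SignType, a ≠ 0 → b ≠ 0 → c ≠ 0 → a ≠ -b → (b = c ↔ a = c) := by
  intro a b c
  cases a <;> cases b <;> cases c <;> decide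

/-- Parity half of Descartes' rule, inductive form: for a polynomial with `n` monomials whose lowest
nonzero coefficient sits at `t`, the number of sign variations is even iff the leading coefficient and
the coefficient at `t` have the same sign.  Induction on `n`, erasing the leading term. -/
theorem even_signVariations_iff_aux {R : Type*} [Semiring R] [LinearOrder R] (n : ℕ) :
    ∀ (Q : R[X]) (t : ℕ), Q.support.card = n → Q.coeff t ≠ 0 → (∀ m < t, Q.coeff m = 0) →
      (Even Q.signVariations ↔ SignType.sign Q.leadingCoeff = SignType.sign (Q.coeff t)) := by
  induction n with
  | zero =>
    intro Q t h0 ht _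
    exact absurd (by rw [card_support_eq_zero.mp h0, coeff_zero]) ht
  | succ n ih =>
    intro Q t hcard ht hlow
    have hQ : Q ≠ 0 := fun h => ht (by rw [h, coeff_zero])
    by_cases hE : Q.eraseLead = 0
    · -- `Q` is a monomial: no sign variation, and `t` is its degree
      have htd : t = Q.natDegree := by
        by_contra hne
        exact ht (by rw [← eraseLead_coeff_of_ne t hne, hE, coeff_zero])
      have hmono : Q = monomial Q.natDegree Q.leadingCoeff := by
        conv_lhs => rw [← eraseLead_add_monomial_natDegree_leadingCoeff Q, hE, zero_add]
      have hsv : Q.signVariations = 0 := by rw [hmono, signVariations_monomial]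
      rw [hsv, htd]
      exact iff_of_true ⟨0, rfl⟩ rfl
    · -- erase the leading term: the lowest coefficient is untouched
      have hc : Q.eraseLead.support.card = n := by
        have := card_support_eraseLead_add_one hQ
        omega
      have htd : t ≠ Q.natDegree := by
        rintro rfl
        obtain ⟨i, hi⟩ := support_nonempty.mpr hE
        have hi' := lt_natDegree_of_mem_eraseLead_support hi
        rw [mem_support_iff, eraseLead_coeff_of_ne i hi'.ne] at hi
        exact hi (hlow i hi')
      have hEt : Q.eraseLead.coeff t = Q.coeff t := eraseLead_coeff_of_ne t htd
      have hih := ih Q.eraseLead t hc (by rwa [hEt]) fun m hm => by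
        rw [eraseLead_coeff]
        split_ifs
        · rfl
        · exact hlow m hm
      rw [hEt] at hih
      have ha : SignType.sign Q.leadingCoeff ≠ 0 := by
        rwa [Ne, sign_eq_zero_iff, leadingCoeff_eq_zero]
      have hb : SignType.sign Q.eraseLead.leadingCoeff ≠ 0 := by
        rwa [Ne, sign_eq_zero_iff, leadingCoeff_eq_zero]
      have hc' : SignType.sign (Q.coeff t) ≠ 0 := by rwa [Ne, sign_eq_zero_iff]
      rw [signVariations_eq_eraseLead_add_ite hQ]
      by_cases hab : SignType.sign Q.leadingCoeff = -SignType.sign Q.eraseLead.leadingCoeff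
      · rw [if_pos hab, Nat.even_add_one, hih]
        exact sign_key_neg _ _ _ ha hb hc' hab
      · rw [if_neg hab, add_zero, hih]
        exact sign_key_pos _ _ _ ha hb hc' hab

/-- **Parity half of Descartes' rule of signs.**  If `t` is the lowest exponent of `Q` (so `Q ≠ 0`),
the number of sign variations of `Q` is even iff its leading coefficient and its trailing
coefficient `Q.coeff t` have the same sign. -/
theorem even_signVariations_iff {R : Type*} [Semiring R] [LinearOrder R] (Q : R[X]) (t : ℕ)
    (ht : Q.coeff t ≠ 0) (hlow : ∀ m < t, Q.coeff m = 0) :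
    Even Q.signVariations ↔ SignType.sign Q.leadingCoeff = SignType.sign (Q.coeff t) :=
  even_signVariations_iff_aux _ Q t rfl ht hlow

/-! ### Sparse polynomials with nonnegative extreme coefficients -/

/-- Adding one monomial adds at most one exponent to the support. -/
theorem card_support_add_C_mul_X_pow_le {p : ℝ[X]} {m : ℕ} (hp : p.support.card ≤ m) (c : ℝ)
    (k : ℕ) : (p + C c * X ^ k).support.card ≤ m + 1 :=
  (card_le_card support_add).trans ((card_union_le _ _).trans
    (add_le_add hp card_support_C_mul_X_pow_le_one))

/-- A real polynomial `c₀ X^{k₀} + g + c₅ X^{k₅}` with `c₀, c₅ ≥ 0`, `g` having at most four monomials,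
all with exponents strictly between `k₀ < k₅`, has at most `4` sign variations: fewer variations than
monomials, at most five monomials if `c₀ = 0` or `c₅ = 0`, and an EVEN number `< 6` of variations if
both extreme coefficients are positive. -/
theorem signVariations_le_four (g : ℝ[X]) (c₀ c₅ : ℝ) (k₀ k₅ : ℕ) (hk : k₀ < k₅)
    (hg4 : g.support.card ≤ 4) (hg : ∀ n, n ≤ k₀ ∨ k₅ ≤ n → g.coeff n = 0)
    (h₀ : 0 ≤ c₀) (h₅ : 0 ≤ c₅) :
    (C c₀ * X ^ k₀ + g + C c₅ * X ^ k₅).signVariations ≤ 4 := by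
  have hcoeff : ∀ n, (C c₀ * X ^ k₀ + g + C c₅ * X ^ k₅).coeff n =
      (if n = k₀ then c₀ else 0) + g.coeff n + (if n = k₅ then c₅ else 0) := fun n => by
    simp only [coeff_add, coeff_C_mul_X_pow]
  have hsupp : (C c₀ * X ^ k₀ + g + C c₅ * X ^ k₅).support.card ≤
      (C c₀ * X ^ k₀).support.card + 4 + 1 :=
    (card_le_card support_add).trans <| (card_union_le _ _).trans <|
      add_le_add ((card_le_card support_add).trans <| (card_union_le _ _).trans <|
        Nat.add_le_add_left hg4 _) card_support_C_mul_X_pow_le_one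
  have h1 : (C c₀ * X ^ k₀).support.card ≤ 1 := card_support_C_mul_X_pow_le_one
  by_cases hf0 : C c₀ * X ^ k₀ + g + C c₅ * X ^ k₅ = 0
  · rw [hf0, signVariations_zero]
    exact Nat.zero_le _
  have hlt := signVariations_lt_card_support hf0
  rcases h₀.eq_or_lt with h0 | h0
  · -- `c₀ = 0`: at most five monomials
    have : (C c₀ * X ^ k₀).support.card = 0 := by
      rw [← h0, C_0, zero_mul, support_zero, card_empty]
    omega
  rcases h₅.eq_or_lt with h5 | h5
  · -- `c₅ = 0`: at most five monomials
    have : (C c₀ * X ^ k₀ + g + C c₅ * X ^ k₅).support.card ≤ 1 + 4 := by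
      rw [← h5, C_0, zero_mul, add_zero]
      exact (card_le_card support_add).trans ((card_union_le _ _).trans (add_le_add h1 hg4))
    omega
  -- both extreme coefficients positive: the number of sign variations is even and `< 6`
  set f := C c₀ * X ^ k₀ + g + C c₅ * X ^ k₅ with hf
  have hk₀ : f.coeff k₀ = c₀ := by
    rw [hcoeff, if_pos rfl, if_neg hk.ne, hg k₀ (Or.inl le_rfl), add_zero, add_zero]
  have hk₅ : f.coeff k₅ = c₅ := by
    rw [hcoeff, if_neg hk.ne', if_pos rfl, hg k₅ (Or.inr le_rfl), zero_add, zero_add]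
  have hnd : f.natDegree = k₅ :=
    natDegree_eq_of_le_of_coeff_ne_zero
      (natDegree_le_iff_coeff_eq_zero.mpr fun N hN => by
        rw [hcoeff, if_neg (show N ≠ k₀ by omega), if_neg (show N ≠ k₅ by omega),
          hg N (Or.inr hN.le), add_zero, add_zero])
      (by rw [hk₅]; exact h5.ne')
  have hlead : f.leadingCoeff = c₅ := by rw [leadingCoeff, hnd, hk₅]
  have heven : Even f.signVariations := by
    rw [even_signVariations_iff f k₀ (by rw [hk₀]; exact h0.ne') fun m hm => by
        rw [hcoeff, if_neg (show m ≠ k₀ by omega), if_neg (show m ≠ k₅ by omega),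
          hg m (Or.inl hm.le), add_zero, add_zero],
      hlead, hk₀, sign_pos h5, sign_pos h0]
  obtain ⟨r, hr⟩ := heven
  omega

/-! ### The `2 × 2` pencil determinant -/

/-- The determinant of the `2 × 2` pencil `X^e • J + X^{d₁} • P + X^{d₂} • Q` as a six-term
exponential sum; the extreme terms are `det P · X^{2d₁}` and `det Q · X^{2d₂}`. -/
theorem det_pencil_eq (e d₁ d₂ : ℕ) (J P Q : Matrix (Fin 2) (Fin 2) ℝ) :
    Matrix.det (((X : ℝ[X]) ^ e) • J.map C + ((X : ℝ[X]) ^ d₁) • P.map C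
        + ((X : ℝ[X]) ^ d₂) • Q.map C)
      = C P.det * X ^ (d₁ + d₁)
        + (C (J 0 0 * P 1 1 + P 0 0 * J 1 1 - J 0 1 * P 1 0 - P 0 1 * J 1 0) * X ^ (d₁ + e)
          + C J.det * X ^ (e + e)
          + C (P 0 0 * Q 1 1 + Q 0 0 * P 1 1 - P 0 1 * Q 1 0 - Q 0 1 * P 1 0) * X ^ (d₁ + d₂)
          + C (J 0 0 * Q 1 1 + Q 0 0 * J 1 1 - J 0 1 * Q 1 0 - Q 0 1 * J 1 0) * X ^ (e + d₂))
        + C Q.det * X ^ (d₂ + d₂) := by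
  simp only [Matrix.det_fin_two, Matrix.add_apply, Matrix.smul_apply, Matrix.map_apply,
    smul_eq_mul, map_add, map_sub, map_mul]
  ring

/-- Distinct positive roots are no more than positive roots counted with multiplicity. -/
theorem card_filter_pos_le_countP (f : ℝ[X]) :
    (f.roots.toFinset.filter (fun t => 0 < t)).card ≤ f.roots.countP (fun t => 0 < t) := by
  calc (f.roots.toFinset.filter (fun t => 0 < t)).card
      = (f.roots.filter (fun t => 0 < t)).toFinset.card := by rw [Multiset.toFinset_filter]
    _ ≤ (f.roots.filter (fun t => 0 < t)).card := Multiset.toFinset_card_le _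
    _ = f.roots.countP (fun t => 0 < t) := (Multiset.countP_eq_card_filter _ _).symm

end StubVLawTwo

/-- **Registered stub `stub_vLaw_two`** (the V-law at `n = 2`): for `2 × 2` real matrices with
`P, Q ⪰ 0` and exponents `d₁ < e < d₂`, `det (X^e J + X^{d₁} P + X^{d₂} Q)` has at most `4` distinct
positive zeros.  The determinant is a six-term exponential sum whose unshared extreme coefficients are
`det P ≥ 0` (at `2d₁`) and `det Q ≥ 0` (at `2d₂`); if either vanishes at most five monomials remain
(`< 5` sign variations), and if both are positive the number of sign variations is even and `< 6`;
either way `≤ 4`, and Descartes' rule (`Polynomial.roots_countP_pos_le_signVariations`) concludes. -/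
theorem stub_vLaw_two (e d₁ d₂ : ℕ) (J P Q : Matrix (Fin 2) (Fin 2) ℝ)
    (hP : P.PosSemidef) (hQ : Q.PosSemidef) (h₁ : d₁ < e) (h₂ : e < d₂) :
    ((Matrix.det (((Polynomial.X : Polynomial ℝ) ^ e) • J.map Polynomial.C
        + ((Polynomial.X : Polynomial ℝ) ^ d₁) • P.map Polynomial.C
        + ((Polynomial.X : Polynomial ℝ) ^ d₂) • Q.map Polynomial.C)).roots.toFinset.filter
          (fun t => 0 < t)).card ≤ 4 := by
  rw [StubVLawTwo.det_pencil_eq]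
  refine (StubVLawTwo.card_filter_pos_le_countP _).trans
    ((roots_countP_pos_le_signVariations _).trans ?_)
  refine StubVLawTwo.signVariations_le_four _ _ _ _ _ (by omega) ?_ ?_ hP.det_nonneg hQ.det_nonneg
  · exact StubVLawTwo.card_support_add_C_mul_X_pow_le
      (StubVLawTwo.card_support_add_C_mul_X_pow_le
        (StubVLawTwo.card_support_add_C_mul_X_pow_le card_support_C_mul_X_pow_le_one _ _) _ _) _ _
  · intro n hn
    simp only [coeff_add, coeff_C_mul_X_pow]
    split_ifs <;> first | omega | simp

end Summit.ValiantsHypothesis.ValiantsHypothesis.Theorems.LacunarySymmetroidMatrixDescartes
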